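import Summits.CriticalPhenomena.PercolationContinuityZ3.Theorems.PercNearOneGluingNoHeavyLowerTailConditionedBHK
import Literature.Probability.Percolation.TwoSetConditionalAssociationRC
import HarnessLib

/-!
# `NoHeavyLowerTail` (stmt-CriticalPhenomena-4575) — W-BHK and the set form of dR3 for the RANDOM-CLUSTER measure `φ_{𝐩,q}`, `q ≥ 1`

Support file (prover prim-gen-kcluster gen 46; `--supports stmt-CriticalPhenomena-4575`).  No named facts, no sorries, no definitions.
Companion of `…LowerTailConditionedBHK` (the same theorems for `prodBernoulli w`): every input of the chain there — BHK's two-cluster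
Theorem 1.4 with vertex sets and Harris' inequality — has a random-cluster version in the tree for `φ = rcMeasureW w q ∅`, `q ≥ 1`
(van den Berg–Häggström–Kahn's Theorem 2.1, `setClusterEventExchange_rc`; FKG, `rcMeasureW_fkg`), so the conditioned inequalities
hold verbatim for `φ_{𝐩,q}` (free boundary condition, arbitrary edge parameters, any finite vertex type):

* `condBHK_rc` / `condBHK_conn_rc` — W-BHK: for `𝒜, ℬ` closed under enlarging `C_S` and `W` closed under enlarging `C_X` and under
  enlarging `C_Y` (e.g. `W = {X ~ Y}`): `φ(W ∩ 𝒜 ∩ {S↮X}) · φ(W ∩ ℬ ∩ {S↮Y}) ≤ φ(W ∩ 𝒜 ∩ ℬ) · φ(W ∩ {S↮X} ∩ {S↮Y})`;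
* `negCorr_of_condBHK_rc`, `condDR4_rc` — `P(W | 𝒜, S ↮ X) ≤ P(W) ≤ P(W | ℰ)` (`ℰ` increasing);
* `dualRowR3_sets_rc`, `posCorr_conn_sets_rc` — **given `{X ~ Y}`, the events `{S ~ X}` and `{S ~ Y}` are positively correlated under
  `φ_{𝐩,q}`, `q ≥ 1`**, for arbitrary vertex sets `S, X, Y`.
At `q = 1` (`rcMeasureW_one`) these are the statements of `…LowerTailConditionedBHK`.  Auxiliary: FKG in the mixed event forms
(`rc_fkg_upper_lower`, `rc_fkg_lower`) and Theorem 1.4 with sets in event form for `φ` (`negCorr_sets_rc`, `posCorr_notConn_sets_rc`).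
[cite: VandenbergHaggstromKahn2005, Thm. 2.1 (p. 9), Lemma 2.2 (p. 10), Thm. 1.4 (p. 7); Grimmett2006, Thm. (3.8)(b)]
-/

noncomputable section

namespace Summit.CriticalPhenomena.PercolationContinuityZ3.Theorems

namespace ConditionedBHK

open MeasureTheory Set Literature.Probability.Percolation Literature.Probability.LatticeModels
open Literature.Probability.Percolation.TwoSetExchange

section Generic

variable {V : Type*}

/-- An event closed under enlarging `C_S` is the event of a monotone predicate of `C_S`. [folklore] -/
theorem setOf_exists_eq_of_closed (S : Set V) {A : Set (BondConfig V)}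
    (hA : ∀ ⦃ω ω' : BondConfig V⦄, (⋃ s ∈ S, openEdgeCluster ω s) ⊆ (⋃ s ∈ S, openEdgeCluster ω' s) → ω ∈ A → ω' ∈ A) :
    {ω : BondConfig V | ∃ ω₀ ∈ A, (⋃ s ∈ S, openEdgeCluster ω₀ s) ⊆ ⋃ s ∈ S, openEdgeCluster ω s} = A := by
  ext ω
  exact ⟨fun ⟨ω₀, h₀, h₁⟩ => hA h₁ h₀, fun h => ⟨ω, h, subset_rfl⟩⟩

end Generic

/-! ### FKG for `φ_{𝐩,q}`, `q ≥ 1`, in the two mixed event forms -/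

section RC

universe u

variable {V : Type u} [Fintype V] (w : Sym2 V → unitInterval) {q : ℝ} (hq : 1 ≤ q) (S X Y : Set V)
include hq

/-- FKG for `φ = rcMeasureW w q ∅`, `q ≥ 1`, an increasing and a decreasing event: `φ(A ∩ D) ≤ φ(A) φ(D)` (from the tree's
`rcMeasureW_fkg` for `A`, `Dᶜ`). [cite: Grimmett2006, Thm. (3.8)(b)] -/
theorem rc_fkg_upper_lower {A D : Set (BondConfig V)} (hA : IsUpperSet A) (hD : IsLowerSet D) :
    (rcMeasureW w q ∅).real (A ∩ D) ≤ (rcMeasureW w q ∅).real A * (rcMeasureW w q ∅).real D := by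
  haveI := isProbabilityMeasure_rcMeasureW w (one_pos.trans_le hq) (∅ : Set V)
  have m : ∀ E : Set (BondConfig V), MeasurableSet E := fun _ => MeasurableSet.of_discrete
  have h1 := rcMeasureW_fkg w hq ∅ hA hD.compl
  have e1 : (rcMeasureW w q ∅).real (A ∩ D) + (rcMeasureW w q ∅).real (A ∩ Dᶜ) = (rcMeasureW w q ∅).real A := by
    rw [← Set.sdiff_eq]; exact measureReal_inter_add_sdiff (m D)
  have e2 : (rcMeasureW w q ∅).real Dᶜ = 1 - (rcMeasureW w q ∅).real D := probReal_compl_eq_one_sub (m D)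
  rw [e2] at h1
  nlinarith [h1, e1]

/-- FKG for `φ = rcMeasureW w q ∅`, `q ≥ 1`, two decreasing events: `φ(D) φ(D') ≤ φ(D ∩ D')`. [cite: Grimmett2006, Thm. (3.8)(b)] -/
theorem rc_fkg_lower {D D' : Set (BondConfig V)} (hD : IsLowerSet D) (hD' : IsLowerSet D') :
    (rcMeasureW w q ∅).real D * (rcMeasureW w q ∅).real D' ≤ (rcMeasureW w q ∅).real (D ∩ D') := by
  haveI := isProbabilityMeasure_rcMeasureW w (one_pos.trans_le hq) (∅ : Set V)
  have m : ∀ E : Set (BondConfig V), MeasurableSet E := fun _ => MeasurableSet.of_discrete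
  have h1 := rc_fkg_upper_lower w hq hD'.compl hD
  have e1 : (rcMeasureW w q ∅).real (D ∩ D') + (rcMeasureW w q ∅).real (D ∩ D'ᶜ) = (rcMeasureW w q ∅).real D := by
    rw [← Set.sdiff_eq]; exact measureReal_inter_add_sdiff (m D')
  have e2 : (rcMeasureW w q ∅).real D'ᶜ = 1 - (rcMeasureW w q ∅).real D' := probReal_compl_eq_one_sub (m D')
  rw [e2, inter_comm] at h1
  nlinarith [h1, e1]

/-! ### Theorem 1.4 with sets for `φ_{𝐩,q}`, event form -/

/-- **BHK's Theorem 1.4 with sets for `φ_{𝐩,q}`, `q ≥ 1`, event form** (from the tree's `setClusterEventExchange_rc`): for `A`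
closed under enlarging `C_S`, `B` closed under enlarging `C_T`, `D = {S ↮ T}`: `φ(D ∩ (A ∩ B)) · φ(D) ≤ φ(D ∩ A) · φ(D ∩ B)`.
[cite: VandenbergHaggstromKahn2005, Thm. 2.1 (p. 9), Thm. 1.4 (p. 7) — corollary of the tree's random-cluster form] -/
theorem negCorr_sets_rc (T : Set V) {A B : Set (BondConfig V)}
    (hA : ∀ ⦃ω ω' : BondConfig V⦄, (⋃ s ∈ S, openEdgeCluster ω s) ⊆ (⋃ s ∈ S, openEdgeCluster ω' s) → ω ∈ A → ω' ∈ A)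
    (hB : ∀ ⦃ω ω' : BondConfig V⦄, (⋃ t ∈ T, openEdgeCluster ω t) ⊆ (⋃ t ∈ T, openEdgeCluster ω' t) → ω ∈ B → ω' ∈ B) :
    (rcMeasureW w q ∅).real ({ω : BondConfig V | ∀ s ∈ S, ∀ t ∈ T, ¬ (openGraph ω).Reachable s t} ∩ (A ∩ B)) *
        (rcMeasureW w q ∅).real {ω : BondConfig V | ∀ s ∈ S, ∀ t ∈ T, ¬ (openGraph ω).Reachable s t} ≤
      (rcMeasureW w q ∅).real ({ω : BondConfig V | ∀ s ∈ S, ∀ t ∈ T, ¬ (openGraph ω).Reachable s t} ∩ A) *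
        (rcMeasureW w q ∅).real ({ω : BondConfig V | ∀ s ∈ S, ∀ t ∈ T, ¬ (openGraph ω).Reachable s t} ∩ B) := by
  have key := setClusterEventExchange_rc w hq S T
    (fun C => ∃ ω₀ ∈ A, (⋃ s ∈ S, openEdgeCluster ω₀ s) ⊆ C) (fun _ => True)
    (fun C => ∃ ω₀ ∈ B, (⋃ t ∈ T, openEdgeCluster ω₀ t) ⊆ C) (fun _ => True)
    (fun _ _ h hex => hex.imp fun ω₀ hω₀ => ⟨hω₀.1, hω₀.2.trans h⟩) (fun _ _ _ _ => trivial)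
    (fun _ _ h hex => hex.imp fun ω₀ hω₀ => ⟨hω₀.1, hω₀.2.trans h⟩) (fun _ _ _ _ => trivial)
  beta_reduce at key
  rw [setOf_exists_eq_of_closed S hA, setOf_exists_eq_of_closed T hB] at key
  simpa only [setOf_true, inter_univ, univ_inter] using key

/-- **Given `{S ↮ T}`, `{S ↮ X}` and any event closed under enlarging `C_T` are positively correlated, for `φ_{𝐩,q}`, `q ≥ 1`**:
`φ(D ∩ {S↮X}) · φ(D ∩ B) ≤ φ(D) · φ(D ∩ ({S↮X} ∩ B))`, `D = {S ↮ T}` (Theorem 1.4 for `{S ~ X}` and `B`, complemented).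
[cite: VandenbergHaggstromKahn2005, Thm. 2.1 (p. 9), Thm. 1.4 (p. 7) — corollary] -/
theorem posCorr_notConn_sets_rc (T : Set V) {B : Set (BondConfig V)}
    (hB : ∀ ⦃ω ω' : BondConfig V⦄, (⋃ t ∈ T, openEdgeCluster ω t) ⊆ (⋃ t ∈ T, openEdgeCluster ω' t) → ω ∈ B → ω' ∈ B) :
    (rcMeasureW w q ∅).real ({ω : BondConfig V | ∀ s ∈ S, ∀ t ∈ T, ¬ (openGraph ω).Reachable s t} ∩
          {ω : BondConfig V | ∀ s ∈ S, ∀ x ∈ X, ¬ (openGraph ω).Reachable s x}) *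
        (rcMeasureW w q ∅).real ({ω : BondConfig V | ∀ s ∈ S, ∀ t ∈ T, ¬ (openGraph ω).Reachable s t} ∩ B) ≤
      (rcMeasureW w q ∅).real {ω : BondConfig V | ∀ s ∈ S, ∀ t ∈ T, ¬ (openGraph ω).Reachable s t} *
        (rcMeasureW w q ∅).real ({ω : BondConfig V | ∀ s ∈ S, ∀ t ∈ T, ¬ (openGraph ω).Reachable s t} ∩
          ({ω : BondConfig V | ∀ s ∈ S, ∀ x ∈ X, ¬ (openGraph ω).Reachable s x} ∩ B)) := by
  haveI := isProbabilityMeasure_rcMeasureW w (one_pos.trans_le hq) (∅ : Set V)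
  set μ := rcMeasureW w q ∅ with hμ
  set D : Set (BondConfig V) := {ω | ∀ s ∈ S, ∀ t ∈ T, ¬ (openGraph ω).Reachable s t} with hD
  set E : Set (BondConfig V) := ⋃ s ∈ S, ⋃ x ∈ X, openConn s x with hE
  have hDX : ({ω : BondConfig V | ∀ s ∈ S, ∀ x ∈ X, ¬ (openGraph ω).Reachable s x}) = Eᶜ := (compl_conn_eq S X).symm
  rw [hDX]
  have key : μ.real (D ∩ (E ∩ B)) * μ.real D ≤ μ.real (D ∩ E) * μ.real (D ∩ B) :=
    negCorr_sets_rc w hq S T (conn_closed_left S X) hB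
  have m : ∀ A : Set (BondConfig V), MeasurableSet A := fun _ => MeasurableSet.of_discrete
  have e1 : μ.real (D ∩ Eᶜ) = μ.real D - μ.real (D ∩ E) := by
    rw [← measureReal_inter_add_sdiff (s := D) (m E), Set.sdiff_eq]; ring
  have e2 : μ.real (D ∩ (Eᶜ ∩ B)) = μ.real (D ∩ B) - μ.real (D ∩ (E ∩ B)) := by
    have f1 : (D ∩ B) ∩ E = D ∩ (E ∩ B) := by ext ω; simp only [mem_inter_iff]; tauto
    have f2 : (D ∩ B) \ E = D ∩ (Eᶜ ∩ B) := by ext ω; simp only [mem_sdiff, mem_inter_iff, mem_compl_iff]; tauto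
    rw [← measureReal_inter_add_sdiff (s := D ∩ B) (m E), f1, f2]; ring
  rw [e1, e2]
  nlinarith [key]

/-! ### W-BHK for `φ_{𝐩,q}`, `q ≥ 1` -/

/-- **W-BHK for the random-cluster measure `φ_{𝐩,q}`, `q ≥ 1`**: for vertex sets `S, X, Y`, events `𝒜, ℬ` closed under enlarging
`C_S`, and `W` closed under enlarging `C_X` and under enlarging `C_Y` (e.g. `W = {X ~ Y}`), with `D_X = {S ↮ X}`, `D_Y = {S ↮ Y}`:
`φ(D_X ∩ (𝒜 ∩ W)) · φ(D_Y ∩ (ℬ ∩ W)) ≤ φ(W ∩ (𝒜 ∩ ℬ)) · φ(D_Y ∩ (D_X ∩ W))`.  Same chain as `condBHK` with BHK's Theorem 2.1 and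
FKG (Lemma 2.2) in place of Theorem 1.4 and Harris; at `q = 1` (`rcMeasureW_one`) it is `condBHK`. [this work] -/
theorem condBHK_rc {𝒜 ℬ W : Set (BondConfig V)}
    (h𝒜 : ∀ ⦃ω ω' : BondConfig V⦄, (⋃ s ∈ S, openEdgeCluster ω s) ⊆ (⋃ s ∈ S, openEdgeCluster ω' s) → ω ∈ 𝒜 → ω' ∈ 𝒜)
    (hℬ : ∀ ⦃ω ω' : BondConfig V⦄, (⋃ s ∈ S, openEdgeCluster ω s) ⊆ (⋃ s ∈ S, openEdgeCluster ω' s) → ω ∈ ℬ → ω' ∈ ℬ)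
    (hWX : ∀ ⦃ω ω' : BondConfig V⦄, (⋃ x ∈ X, openEdgeCluster ω x) ⊆ (⋃ x ∈ X, openEdgeCluster ω' x) → ω ∈ W → ω' ∈ W)
    (hWY : ∀ ⦃ω ω' : BondConfig V⦄, (⋃ y ∈ Y, openEdgeCluster ω y) ⊆ (⋃ y ∈ Y, openEdgeCluster ω' y) → ω ∈ W → ω' ∈ W) :
    (rcMeasureW w q ∅).real ({ω : BondConfig V | ∀ s ∈ S, ∀ x ∈ X, ¬ (openGraph ω).Reachable s x} ∩ (𝒜 ∩ W)) *
        (rcMeasureW w q ∅).real ({ω : BondConfig V | ∀ s ∈ S, ∀ y ∈ Y, ¬ (openGraph ω).Reachable s y} ∩ (ℬ ∩ W)) ≤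
      (rcMeasureW w q ∅).real (W ∩ (𝒜 ∩ ℬ)) *
        (rcMeasureW w q ∅).real ({ω : BondConfig V | ∀ s ∈ S, ∀ y ∈ Y, ¬ (openGraph ω).Reachable s y} ∩
          ({ω : BondConfig V | ∀ s ∈ S, ∀ x ∈ X, ¬ (openGraph ω).Reachable s x} ∩ W)) := by
  haveI := isProbabilityMeasure_rcMeasureW w (one_pos.trans_le hq) (∅ : Set V)
  set μ := rcMeasureW w q ∅ with hμ
  set DX : Set (BondConfig V) := {ω | ∀ s ∈ S, ∀ x ∈ X, ¬ (openGraph ω).Reachable s x} with hDX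
  set DY : Set (BondConfig V) := {ω | ∀ s ∈ S, ∀ y ∈ Y, ¬ (openGraph ω).Reachable s y} with hDY
  have u𝒜 : IsUpperSet 𝒜 := FrontierDecRows.isUpperSet_of_clusterMono S h𝒜
  have uℬ : IsUpperSet ℬ := FrontierDecRows.isUpperSet_of_clusterMono S hℬ
  have uW : IsUpperSet W := FrontierDecRows.isUpperSet_of_clusterMono X hWX
  have lX : IsLowerSet DX := isLowerSet_notConn S X
  have lY : IsLowerSet DY := isLowerSet_notConn S Y
  have h1 : μ.real (DX ∩ (𝒜 ∩ W)) * μ.real DX ≤ μ.real (DX ∩ 𝒜) * μ.real (DX ∩ W) := negCorr_sets_rc w hq S X h𝒜 hWX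
  have h2 : μ.real (DY ∩ (ℬ ∩ W)) * μ.real DY ≤ μ.real (DY ∩ ℬ) * μ.real (DY ∩ W) := negCorr_sets_rc w hq S Y hℬ hWY
  have h3a : μ.real (DX ∩ 𝒜) ≤ μ.real 𝒜 * μ.real DX := by rw [inter_comm]; exact rc_fkg_upper_lower w hq u𝒜 lX
  have h3b : μ.real (DY ∩ ℬ) ≤ μ.real ℬ * μ.real DY := by rw [inter_comm]; exact rc_fkg_upper_lower w hq uℬ lY
  have h3c : μ.real 𝒜 * μ.real ℬ ≤ μ.real (𝒜 ∩ ℬ) := rcMeasureW_fkg w hq ∅ u𝒜 uℬ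
  have h3d : μ.real DX * μ.real DY ≤ μ.real (DX ∩ DY) := rc_fkg_lower w hq lX lY
  have h4a : μ.real (DX ∩ W) ≤ μ.real W * μ.real DX := by rw [inter_comm]; exact rc_fkg_upper_lower w hq uW lX
  have h4b : μ.real W * μ.real (𝒜 ∩ ℬ) ≤ μ.real (W ∩ (𝒜 ∩ ℬ)) := rcMeasureW_fkg w hq ∅ uW (u𝒜.inter uℬ)
  have h5 : μ.real (DX ∩ DY) * μ.real (DY ∩ W) ≤ μ.real DY * μ.real (DY ∩ (DX ∩ W)) := by
    have := posCorr_notConn_sets_rc w hq S X Y hWY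
    rw [inter_comm DY DX] at this
    exact this
  have hL1d : μ.real (DX ∩ (𝒜 ∩ W)) ≤ μ.real DX := measureReal_mono inter_subset_left
  have hL2d : μ.real (DY ∩ (ℬ ∩ W)) ≤ μ.real DY := measureReal_mono inter_subset_left
  exact chain_real measureReal_nonneg measureReal_nonneg measureReal_nonneg measureReal_nonneg measureReal_nonneg
    measureReal_nonneg measureReal_nonneg measureReal_nonneg measureReal_nonneg measureReal_nonneg measureReal_nonneg
    measureReal_nonneg hL1d hL2d h1 h2 h3a h3b h3c h3d h4a h4b h5

/-- **W-BHK for `φ_{𝐩,q}`, `q ≥ 1`, with `W = {X ~ Y}`.** [this work] -/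
theorem condBHK_conn_rc {𝒜 ℬ : Set (BondConfig V)}
    (h𝒜 : ∀ ⦃ω ω' : BondConfig V⦄, (⋃ s ∈ S, openEdgeCluster ω s) ⊆ (⋃ s ∈ S, openEdgeCluster ω' s) → ω ∈ 𝒜 → ω' ∈ 𝒜)
    (hℬ : ∀ ⦃ω ω' : BondConfig V⦄, (⋃ s ∈ S, openEdgeCluster ω s) ⊆ (⋃ s ∈ S, openEdgeCluster ω' s) → ω ∈ ℬ → ω' ∈ ℬ) :
    (rcMeasureW w q ∅).real ({ω : BondConfig V | ∀ s ∈ S, ∀ x ∈ X, ¬ (openGraph ω).Reachable s x} ∩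
          (𝒜 ∩ ⋃ x ∈ X, ⋃ y ∈ Y, openConn x y)) *
        (rcMeasureW w q ∅).real ({ω : BondConfig V | ∀ s ∈ S, ∀ y ∈ Y, ¬ (openGraph ω).Reachable s y} ∩
          (ℬ ∩ ⋃ x ∈ X, ⋃ y ∈ Y, openConn x y)) ≤
      (rcMeasureW w q ∅).real ((⋃ x ∈ X, ⋃ y ∈ Y, openConn x y) ∩ (𝒜 ∩ ℬ)) *
        (rcMeasureW w q ∅).real ({ω : BondConfig V | ∀ s ∈ S, ∀ y ∈ Y, ¬ (openGraph ω).Reachable s y} ∩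
          ({ω : BondConfig V | ∀ s ∈ S, ∀ x ∈ X, ¬ (openGraph ω).Reachable s x} ∩ ⋃ x ∈ X, ⋃ y ∈ Y, openConn x y)) :=
  condBHK_rc w hq S X Y h𝒜 hℬ (conn_closed_left X Y) (conn_closed_right X Y)

/-- **`W` is negatively correlated with `𝒜 ∩ {S ↮ X}` under `φ_{𝐩,q}`, `q ≥ 1`**: `φ({S↮X} ∩ (𝒜 ∩ W)) ≤ φ(W) · φ({S↮X} ∩ 𝒜)` for `𝒜`
closed under enlarging `C_S` and `W` closed under enlarging `C_X`. [this work] -/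
theorem negCorr_of_condBHK_rc {𝒜 W : Set (BondConfig V)}
    (h𝒜 : ∀ ⦃ω ω' : BondConfig V⦄, (⋃ s ∈ S, openEdgeCluster ω s) ⊆ (⋃ s ∈ S, openEdgeCluster ω' s) → ω ∈ 𝒜 → ω' ∈ 𝒜)
    (hWX : ∀ ⦃ω ω' : BondConfig V⦄, (⋃ x ∈ X, openEdgeCluster ω x) ⊆ (⋃ x ∈ X, openEdgeCluster ω' x) → ω ∈ W → ω' ∈ W) :
    (rcMeasureW w q ∅).real ({ω : BondConfig V | ∀ s ∈ S, ∀ x ∈ X, ¬ (openGraph ω).Reachable s x} ∩ (𝒜 ∩ W)) ≤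
      (rcMeasureW w q ∅).real W *
        (rcMeasureW w q ∅).real ({ω : BondConfig V | ∀ s ∈ S, ∀ x ∈ X, ¬ (openGraph ω).Reachable s x} ∩ 𝒜) := by
  haveI := isProbabilityMeasure_rcMeasureW w (one_pos.trans_le hq) (∅ : Set V)
  set μ := rcMeasureW w q ∅ with hμ
  set DX : Set (BondConfig V) := {ω | ∀ s ∈ S, ∀ x ∈ X, ¬ (openGraph ω).Reachable s x} with hDX
  have uW : IsUpperSet W := FrontierDecRows.isUpperSet_of_clusterMono X hWX
  have lX : IsLowerSet DX := isLowerSet_notConn S X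
  have h1 : μ.real (DX ∩ (𝒜 ∩ W)) * μ.real DX ≤ μ.real (DX ∩ 𝒜) * μ.real (DX ∩ W) := negCorr_sets_rc w hq S X h𝒜 hWX
  have h4a : μ.real (DX ∩ W) ≤ μ.real W * μ.real DX := by rw [inter_comm]; exact rc_fkg_upper_lower w hq uW lX
  have hL1d : μ.real (DX ∩ (𝒜 ∩ W)) ≤ μ.real DX := measureReal_mono inter_subset_left
  have n1 : 0 ≤ μ.real (DX ∩ (𝒜 ∩ W)) := measureReal_nonneg
  have n2 : 0 ≤ μ.real (DX ∩ 𝒜) := measureReal_nonneg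
  have n3 : 0 ≤ μ.real W := measureReal_nonneg
  rcases eq_or_lt_of_le (measureReal_nonneg : 0 ≤ μ.real DX) with h0 | hp
  · have : μ.real (DX ∩ (𝒜 ∩ W)) = 0 := le_antisymm (h0 ▸ hL1d) n1
    rw [this]; exact mul_nonneg n3 n2
  · have : μ.real (DX ∩ (𝒜 ∩ W)) * μ.real DX ≤ (μ.real W * μ.real (DX ∩ 𝒜)) * μ.real DX :=
      calc μ.real (DX ∩ (𝒜 ∩ W)) * μ.real DX ≤ μ.real (DX ∩ 𝒜) * μ.real (DX ∩ W) := h1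
        _ ≤ μ.real (DX ∩ 𝒜) * (μ.real W * μ.real DX) := mul_le_mul_of_nonneg_left h4a n2
        _ = (μ.real W * μ.real (DX ∩ 𝒜)) * μ.real DX := by ring
    exact le_of_mul_le_mul_right this hp

/-- **Set form of dR4⁺ for `φ_{𝐩,q}`, `q ≥ 1`**: `φ({S↮X} ∩ (𝒜 ∩ W)) · φ(ℰ) ≤ φ({S↮X} ∩ 𝒜) · φ(W ∩ ℰ)` for every increasing `ℰ`,
i.e. `P(W | 𝒜, S ↮ X) ≤ P(W) ≤ P(W | ℰ)`. [this work] -/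
theorem condDR4_rc {𝒜 W ℰ : Set (BondConfig V)}
    (h𝒜 : ∀ ⦃ω ω' : BondConfig V⦄, (⋃ s ∈ S, openEdgeCluster ω s) ⊆ (⋃ s ∈ S, openEdgeCluster ω' s) → ω ∈ 𝒜 → ω' ∈ 𝒜)
    (hWX : ∀ ⦃ω ω' : BondConfig V⦄, (⋃ x ∈ X, openEdgeCluster ω x) ⊆ (⋃ x ∈ X, openEdgeCluster ω' x) → ω ∈ W → ω' ∈ W)
    (hℰ : IsUpperSet ℰ) :
    (rcMeasureW w q ∅).real ({ω : BondConfig V | ∀ s ∈ S, ∀ x ∈ X, ¬ (openGraph ω).Reachable s x} ∩ (𝒜 ∩ W)) *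
        (rcMeasureW w q ∅).real ℰ ≤
      (rcMeasureW w q ∅).real ({ω : BondConfig V | ∀ s ∈ S, ∀ x ∈ X, ¬ (openGraph ω).Reachable s x} ∩ 𝒜) *
        (rcMeasureW w q ∅).real (W ∩ ℰ) := by
  have uW : IsUpperSet W := FrontierDecRows.isUpperSet_of_clusterMono X hWX
  have h1 := negCorr_of_condBHK_rc w hq S X h𝒜 hWX
  have h2 : (rcMeasureW w q ∅).real W * (rcMeasureW w q ∅).real ℰ ≤ (rcMeasureW w q ∅).real (W ∩ ℰ) :=
    rcMeasureW_fkg w hq ∅ uW hℰ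
  have n2 : 0 ≤ (rcMeasureW w q ∅).real ({ω : BondConfig V | ∀ s ∈ S, ∀ x ∈ X, ¬ (openGraph ω).Reachable s x} ∩ 𝒜) :=
    measureReal_nonneg
  calc (rcMeasureW w q ∅).real ({ω : BondConfig V | ∀ s ∈ S, ∀ x ∈ X, ¬ (openGraph ω).Reachable s x} ∩ (𝒜 ∩ W)) *
        (rcMeasureW w q ∅).real ℰ
      ≤ ((rcMeasureW w q ∅).real W *
          (rcMeasureW w q ∅).real ({ω : BondConfig V | ∀ s ∈ S, ∀ x ∈ X, ¬ (openGraph ω).Reachable s x} ∩ 𝒜)) *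
          (rcMeasureW w q ∅).real ℰ := mul_le_mul_of_nonneg_right h1 measureReal_nonneg
    _ = (rcMeasureW w q ∅).real ({ω : BondConfig V | ∀ s ∈ S, ∀ x ∈ X, ¬ (openGraph ω).Reachable s x} ∩ 𝒜) *
          ((rcMeasureW w q ∅).real W * (rcMeasureW w q ∅).real ℰ) := by ring
    _ ≤ _ := mul_le_mul_of_nonneg_left h2 n2

/-! ### dR3 for sets under `φ_{𝐩,q}`: given `{X ~ Y}`, `{S ~ X}` and `{S ~ Y}` are positively correlated -/

/-- **dR3\* for `φ_{𝐩,q}`, `q ≥ 1`, four-cell form**: with `W = {X ~ Y}`, `E = {S ~ X}`, `F = {S ~ Y}`: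
`φ(Eᶜ ∩ (F ∩ W)) · φ(Fᶜ ∩ (E ∩ W)) ≤ φ(W ∩ (F ∩ E)) · φ(Fᶜ ∩ (Eᶜ ∩ W))`. [this work] -/
theorem dualRowR3_sets_rc :
    (rcMeasureW w q ∅).real ((⋃ s ∈ S, ⋃ x ∈ X, (openConn s x : Set (BondConfig V)))ᶜ ∩
          ((⋃ s ∈ S, ⋃ y ∈ Y, openConn s y) ∩ ⋃ x ∈ X, ⋃ y ∈ Y, openConn x y)) *
        (rcMeasureW w q ∅).real ((⋃ s ∈ S, ⋃ y ∈ Y, (openConn s y : Set (BondConfig V)))ᶜ ∩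
          ((⋃ s ∈ S, ⋃ x ∈ X, openConn s x) ∩ ⋃ x ∈ X, ⋃ y ∈ Y, openConn x y)) ≤
      (rcMeasureW w q ∅).real ((⋃ x ∈ X, ⋃ y ∈ Y, openConn x y) ∩
          ((⋃ s ∈ S, ⋃ y ∈ Y, openConn s y) ∩ ⋃ s ∈ S, ⋃ x ∈ X, (openConn s x : Set (BondConfig V)))) *
        (rcMeasureW w q ∅).real ((⋃ s ∈ S, ⋃ y ∈ Y, (openConn s y : Set (BondConfig V)))ᶜ ∩
          ((⋃ s ∈ S, ⋃ x ∈ X, (openConn s x : Set (BondConfig V)))ᶜ ∩ ⋃ x ∈ X, ⋃ y ∈ Y, openConn x y)) := by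
  rw [compl_conn_eq S X, compl_conn_eq S Y]
  exact condBHK_conn_rc w hq S X Y (conn_closed_left S Y) (conn_closed_left S X)

/-- **dR3\* for `φ_{𝐩,q}`, `q ≥ 1` — given `{X ~ Y}`, the events `{S ~ X}` and `{S ~ Y}` are positively correlated** (arbitrary vertex
sets `S, X, Y`, arbitrary edge parameters, free boundary condition):
`φ(W ∩ {S~X}) · φ(W ∩ {S~Y}) ≤ φ(W) · φ(W ∩ ({S~X} ∩ {S~Y}))`, `W = {X ~ Y}`. [this work] -/
theorem posCorr_conn_sets_rc :
    (rcMeasureW w q ∅).real ((⋃ x ∈ X, ⋃ y ∈ Y, openConn x y) ∩ ⋃ s ∈ S, ⋃ x ∈ X, (openConn s x : Set (BondConfig V))) *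
        (rcMeasureW w q ∅).real ((⋃ x ∈ X, ⋃ y ∈ Y, openConn x y) ∩ ⋃ s ∈ S, ⋃ y ∈ Y, (openConn s y : Set (BondConfig V))) ≤
      (rcMeasureW w q ∅).real (⋃ x ∈ X, ⋃ y ∈ Y, (openConn x y : Set (BondConfig V))) *
        (rcMeasureW w q ∅).real ((⋃ x ∈ X, ⋃ y ∈ Y, openConn x y) ∩
          ((⋃ s ∈ S, ⋃ x ∈ X, (openConn s x : Set (BondConfig V))) ∩ ⋃ s ∈ S, ⋃ y ∈ Y, openConn s y)) := by
  haveI := isProbabilityMeasure_rcMeasureW w (one_pos.trans_le hq) (∅ : Set V)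
  set μ := rcMeasureW w q ∅ with hμ
  set W : Set (BondConfig V) := ⋃ x ∈ X, ⋃ y ∈ Y, openConn x y with hW
  set E : Set (BondConfig V) := ⋃ s ∈ S, ⋃ x ∈ X, openConn s x with hE
  set F : Set (BondConfig V) := ⋃ s ∈ S, ⋃ y ∈ Y, openConn s y with hF
  have key : μ.real (Eᶜ ∩ (F ∩ W)) * μ.real (Fᶜ ∩ (E ∩ W)) ≤ μ.real (W ∩ (F ∩ E)) * μ.real (Fᶜ ∩ (Eᶜ ∩ W)) :=
    dualRowR3_sets_rc w hq S X Y
  have m : ∀ A : Set (BondConfig V), MeasurableSet A := fun _ => MeasurableSet.of_discrete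
  have e1 : (W ∩ E) ∩ F = W ∩ (E ∩ F) := inter_assoc W E F
  have e2 : (W ∩ E) \ F = Fᶜ ∩ (E ∩ W) := by
    ext ω; simp only [mem_sdiff, mem_inter_iff, mem_compl_iff]; tauto
  have e3 : (W ∩ F) ∩ E = W ∩ (E ∩ F) := by
    ext ω; simp only [mem_inter_iff]; tauto
  have e4 : (W ∩ F) \ E = Eᶜ ∩ (F ∩ W) := by
    ext ω; simp only [mem_sdiff, mem_inter_iff, mem_compl_iff]; tauto
  have e5 : (W \ E) ∩ F = Eᶜ ∩ (F ∩ W) := by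
    ext ω; simp only [mem_sdiff, mem_inter_iff, mem_compl_iff]; tauto
  have e6 : (W \ E) \ F = Fᶜ ∩ (Eᶜ ∩ W) := by
    ext ω; simp only [mem_sdiff, mem_inter_iff, mem_compl_iff]; tauto
  have sE : μ.real (W ∩ E) = μ.real (W ∩ (E ∩ F)) + μ.real (Fᶜ ∩ (E ∩ W)) := by
    rw [← measureReal_inter_add_sdiff (s := W ∩ E) (m F) (measure_ne_top _ _), e1, e2]
  have sF : μ.real (W ∩ F) = μ.real (W ∩ (E ∩ F)) + μ.real (Eᶜ ∩ (F ∩ W)) := by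
    rw [← measureReal_inter_add_sdiff (s := W ∩ F) (m E) (measure_ne_top _ _), e3, e4]
  have sW : μ.real W = μ.real (W ∩ E) + (μ.real (Eᶜ ∩ (F ∩ W)) + μ.real (Fᶜ ∩ (Eᶜ ∩ W))) := by
    rw [← measureReal_inter_add_sdiff (s := W) (m E) (measure_ne_top _ _),
      ← measureReal_inter_add_sdiff (s := W \ E) (m F) (measure_ne_top _ _), e5, e6]
  have eFE : W ∩ (F ∩ E) = W ∩ (E ∩ F) := by rw [inter_comm F E]
  rw [eFE] at key
  rw [sE, sF, sW, sE]
  have n1 : 0 ≤ μ.real (W ∩ (E ∩ F)) := measureReal_nonneg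
  have n2 : 0 ≤ μ.real (Fᶜ ∩ (E ∩ W)) := measureReal_nonneg
  have n3 : 0 ≤ μ.real (Eᶜ ∩ (F ∩ W)) := measureReal_nonneg
  have n4 : 0 ≤ μ.real (Fᶜ ∩ (Eᶜ ∩ W)) := measureReal_nonneg
  nlinarith [key, mul_nonneg n1 n1, mul_nonneg n1 n2, mul_nonneg n1 n3, mul_nonneg n1 n4]

end RC

end ConditionedBHK

end Summit.CriticalPhenomena.PercolationContinuityZ3.Theorems

end
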